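import Literature.Computability.MetaComplexity.DLOParitySystems
import HarnessLib

/-!
# Parity constraints on linear orders with witnesses, II: Proposition 1′ (GOR 2024, Prop. 1 for `DLO_n`)

The induction of [Gryaznov–Ovcharov–Riazanov 2024, Proposition 1] assembled from
`DLOParitySystems.lean` (final case, gluing step) and `OrderParitySystems.lean` (pairs, gluing, lifts):

* `OrderParity.glue_case` — one gluing round: separate the form containing the chosen pair `(i, j)`
  (row additions on both parts, `elimForm`), glue (`gluePair` / `glueTriple`, odd-fibre images), solve
  the glued system on `S ∖ {v}` by the induction hypothesis, lift (`glue_step`);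
* `OrderParity.exists_ranking_witness_of_ascending` — Proposition 1′ for systems oriented upwards
  w.r.t. `r`, by induction on `|S|`: an occurring pair starting at or above `t` ⇒ glue its upper end
  into its lower end; else an occurring pair ending at or below `s` ⇒ glue its lower end into its upper
  end; else the final case;
* `OrderParity.exists_ranking_witness` — Proposition 1′: `|S| ≥ |Φ| + 3` forms on off-diagonal pairs
  of `S` (and any triples), `r` injective on `S` with `r s < r t` ⇒ a ranking `r'` and a PROPER witness
  set `W ∋ (s, k, t)` giving every form the value `r` gives it with no witnesses.

Difference from print: the printed Proposition 1 also asserts "`τ(z_{ikj}) = 1` only if `i = s` and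
`j = t`"; here witnesses of the glued solution are copied to the re-inserted element (this is what
makes the glued `z`-parities lift), so that clause is dropped — Lemma 4′ (`DLOResLinTreeLike.lean`) does
not need it.

## References

* S. Gryaznov, S. Ovcharov, A. Riazanov, ACM Trans. Comput. Theory 16(3) (2024) = arXiv:2404.08370,
  §3.1.3, Proposition 1 [GryaznovOvcharovRiazanov2024].
* S. Gryaznov, CSR 2019, LNCS 11532, §3.3, Lemma 3.6 [Gryaznov2019].
-/

namespace Literature.Computability.MetaComplexity

namespace OrderParity

open Finset

/-! ### Row operations on forms with a `z`-part -/

/-- Make the pair `q` occur in no form: add `F₀ ∋ q` (both parts) to every form containing `q`.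
[Gryaznov–Ovcharov–Riazanov 2024, Prop. 1 (proof: "we can leave `x_{ij}` in exactly one equation
`f(v) = α` of `Av = b` by adding some equations")] [cite: GryaznovOvcharovRiazanov2024, Proposition 1] -/
def elimForm (F₀ : Finset (ℕ × ℕ) × Finset (ℕ × ℕ × ℕ)) (q : ℕ × ℕ)
    (F : Finset (ℕ × ℕ) × Finset (ℕ × ℕ × ℕ)) : Finset (ℕ × ℕ) × Finset (ℕ × ℕ × ℕ) :=
  if q ∈ F.1 then (symmDiff F.1 F₀.1, symmDiff F.2 F₀.2) else F

/-- After elimination `q` occurs nowhere (given `q ∈ F₀.1`). [folklore] -/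
theorem not_mem_elimForm {F₀ : Finset (ℕ × ℕ) × Finset (ℕ × ℕ × ℕ)} {q : ℕ × ℕ} (hq : q ∈ F₀.1)
    (F : Finset (ℕ × ℕ) × Finset (ℕ × ℕ × ℕ)) : q ∉ (elimForm F₀ q F).1 := by
  unfold elimForm
  split_ifs with h
  · simp only; rw [Finset.mem_symmDiff]; push Not; exact ⟨fun _ => hq, fun _ => h⟩
  · exact h

/-- The pairs of an eliminated form come from the form or from `F₀`. [folklore] -/
theorem mem_or_mem_of_mem_elimForm {F₀ F : Finset (ℕ × ℕ) × Finset (ℕ × ℕ × ℕ)} {q p : ℕ × ℕ}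
    (hp : p ∈ (elimForm F₀ q F).1) : p ∈ F.1 ∨ p ∈ F₀.1 := by
  unfold elimForm at hp
  split_ifs at hp with h
  · simp only at hp
    rw [Finset.mem_symmDiff] at hp
    rcases hp with ⟨h1, -⟩ | ⟨h2, -⟩
    · exact Or.inl h1
    · exact Or.inr h2
  · exact Or.inl hp

/-- Row operations are invertible on values. [Gryaznov–Ovcharov–Riazanov 2024, Prop. 1 (proof)]
[cite: GryaznovOvcharovRiazanov2024, Proposition 1] -/
theorem value_eq_of_elimForm {r r' : ℕ → ℕ} {W : Finset (ℕ × ℕ × ℕ)}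
    {F₀ F : Finset (ℕ × ℕ) × Finset (ℕ × ℕ × ℕ)} {q : ℕ × ℕ}
    (hF : pairParity r' (elimForm F₀ q F).1 + wParity W (elimForm F₀ q F).2 =
      pairParity r (elimForm F₀ q F).1)
    (h₀ : pairParity r' F₀.1 + wParity W F₀.2 = pairParity r F₀.1) :
    pairParity r' F.1 + wParity W F.2 = pairParity r F.1 := by
  unfold elimForm at hF
  split_ifs at hF with h
  · simp only at hF
    rw [pairParity_symmDiff, pairParity_symmDiff, wParity_symmDiff] at hF
    linear_combination hF - h₀
  · exact hF

/-! ### One gluing round -/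

/-- **One gluing round of Proposition 1** [Gryaznov–Ovcharov–Riazanov 2024, Prop. 1 (proof: "we
'glue' `i` and `j` into `i` [resp. into `j`] as we did in the proof of Lemma 3 … consider the linear
system `Bv = c` excluding this equation … replace each occurrence … apply the induction hypothesis …
extend")]: given the chosen ascending pair `(i, j)` occurring in `F₀ ∈ Φ`, with no other occurring
pair inside `[i, j]`, a gluing direction `v ↦ u` (`{u, v} = {i, j}`, `v ∉ {s, t}`) under which every
other ascending pair off the interval glues to an ascending pair of `S ∖ {v}`, and the induction
hypothesis on `S ∖ {v}`, the system `Φ` has a proper solution with the reference values and a witness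
for `(s, t)`. [cite: GryaznovOvcharovRiazanov2024, Proposition 1] -/
theorem glue_case {S : Finset ℕ} {r : ℕ → ℕ} {s t i j u v : ℕ} (hu : u ∈ S) (hv : v ∈ S)
    (huv : u ≠ v) (hq₀uv : (i, j) = (u, v) ∨ (i, j) = (v, u)) (hrij : r i < r j)
    {Φ : List (Finset (ℕ × ℕ) × Finset (ℕ × ℕ × ℕ))}
    (hΦ : ∀ F ∈ Φ, ∀ p ∈ F.1, p.1 ∈ S ∧ p.2 ∈ S ∧ r p.1 < r p.2)
    {F₀ : Finset (ℕ × ℕ) × Finset (ℕ × ℕ × ℕ)} (hF₀ : F₀ ∈ Φ) (hijF₀ : (i, j) ∈ F₀.1)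
    (hfree : ∀ F ∈ Φ, ∀ p ∈ F.1, p ≠ (i, j) → ¬ (r i ≤ r p.1 ∧ r p.2 ≤ r j))
    (hGasc : ∀ p : ℕ × ℕ, p.1 ∈ S → p.2 ∈ S → r p.1 < r p.2 → p ≠ (i, j) →
      ¬ (r i ≤ r p.1 ∧ r p.2 ≤ r j) →
      (gluePair u v p).1 ∈ S.erase v ∧ (gluePair u v p).2 ∈ S.erase v ∧
        r (gluePair u v p).1 < r (gluePair u v p).2)
    (ih : ∀ Φ' : List (Finset (ℕ × ℕ) × Finset (ℕ × ℕ × ℕ)), Φ'.length + 1 = Φ.length →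
      (∀ F ∈ Φ', ∀ p ∈ F.1, p.1 ∈ S.erase v ∧ p.2 ∈ S.erase v ∧ r p.1 < r p.2) →
      ∃ (r₁ : ℕ → ℕ) (W' : Finset (ℕ × ℕ × ℕ)), Set.InjOn r₁ (S.erase v : Finset ℕ) ∧
        WProper (S.erase v) r₁ W' ∧
        (∀ F ∈ Φ', pairParity r₁ F.1 + wParity W' F.2 = pairParity r F.1) ∧ ∃ k, (s, k, t) ∈ W') :
    ∃ (r' : ℕ → ℕ) (W : Finset (ℕ × ℕ × ℕ)), Set.InjOn r' S ∧ WProper S r' W ∧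
      (∀ F ∈ Φ, pairParity r' F.1 + wParity W F.2 = pairParity r F.1) ∧ ∃ k, (s, k, t) ∈ W := by
  classical
  -- ### elimination: `(i, j)` occurs in `F₀` only
  set B : List (Finset (ℕ × ℕ) × Finset (ℕ × ℕ × ℕ)) := (Φ.erase F₀).map (elimForm F₀ (i, j))
    with hB_def
  have hBmem : ∀ F ∈ B, ∀ p ∈ F.1, ∃ F' ∈ Φ, p ∈ F'.1 := by
    intro F hF p hp
    rw [hB_def, List.mem_map] at hF
    obtain ⟨F₁, hF₁, rfl⟩ := hF
    rcases mem_or_mem_of_mem_elimForm hp with h | h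
    · exact ⟨F₁, List.mem_of_mem_erase hF₁, h⟩
    · exact ⟨F₀, hF₀, h⟩
  have hBij : ∀ F ∈ B, (i, j) ∉ F.1 := by
    intro F hF
    rw [hB_def, List.mem_map] at hF
    obtain ⟨F₁, -, rfl⟩ := hF
    exact not_mem_elimForm hijF₀ F₁
  have hBlen : B.length + 1 = Φ.length := by
    rw [hB_def, List.length_map, List.length_erase_of_mem hF₀]
    have : 0 < Φ.length := List.length_pos_of_mem hF₀
    omega
  have hBrec : ∀ (r' : ℕ → ℕ) (W : Finset (ℕ × ℕ × ℕ)),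
      (∀ F ∈ B, pairParity r' F.1 + wParity W F.2 = pairParity r F.1) →
      pairParity r' F₀.1 + wParity W F₀.2 = pairParity r F₀.1 →
      ∀ F ∈ Φ, pairParity r' F.1 + wParity W F.2 = pairParity r F.1 := by
    intro r' W hBv h₀ F hF
    by_cases hFF₀ : F = F₀
    · rw [hFF₀]; exact h₀
    · have hFB : elimForm F₀ (i, j) F ∈ B := by
        rw [hB_def, List.mem_map]
        exact ⟨F, (List.mem_erase_of_ne hFF₀).2 hF, rfl⟩
      exact value_eq_of_elimForm (hBv _ hFB) h₀
  -- pairs of `B` and of `F₀ ∖ {(i, j)}`: ascending pairs of `S`, not `(i,j)`/`(j,i)`, off the interval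
  have hpair : ∀ F ∈ Φ, ∀ p ∈ F.1, p ≠ (i, j) → p.1 ∈ S ∧ p.2 ∈ S ∧ r p.1 < r p.2 ∧
      p ≠ (u, v) ∧ p ≠ (v, u) ∧ ¬ (r i ≤ r p.1 ∧ r p.2 ≤ r j) := by
    intro F hF p hp hpij
    obtain ⟨h1, h2, hlt⟩ := hΦ F hF p hp
    have hpji : p ≠ (j, i) := fun h => by rw [h] at hlt; simp only at hlt; omega
    refine ⟨h1, h2, hlt, ?_, ?_, hfree F hF p hp hpij⟩
    · rcases hq₀uv with h | h
      · rw [← h]; exact hpij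
      · have hi : i = v := congrArg Prod.fst h
        have hj : j = u := congrArg Prod.snd h
        rw [← hi, ← hj]; exact hpji
    · rcases hq₀uv with h | h
      · have hi : i = u := congrArg Prod.fst h
        have hj : j = v := congrArg Prod.snd h
        rw [← hi, ← hj]; exact hpji
      · rw [← h]; exact hpij
  have hBpairs : ∀ F ∈ B, ∀ p ∈ F.1, p.1 ∈ S ∧ p.2 ∈ S ∧ p.1 ≠ p.2 ∧ p ≠ (u, v) ∧ p ≠ (v, u) := by
    intro F hF p hp
    obtain ⟨F', hF', hp'⟩ := hBmem F hF p hp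
    have hpij : p ≠ (i, j) := fun h => hBij F hF (h ▸ hp)
    obtain ⟨h1, h2, hlt, hpuv, hpvu, -⟩ := hpair F' hF' p hp' hpij
    exact ⟨h1, h2, fun h => by rw [h] at hlt; exact lt_irrefl _ hlt, hpuv, hpvu⟩
  have hF₀pairs : ∀ p ∈ F₀.1, p ≠ (i, j) → p.1 ∈ S ∧ p.2 ∈ S ∧ p.1 ≠ p.2 ∧ p ≠ (u, v) ∧ p ≠ (v, u) := by
    intro p hp hpij
    obtain ⟨h1, h2, hlt, hpuv, hpvu, -⟩ := hpair F₀ hF₀ p hp hpij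
    exact ⟨h1, h2, fun h => by rw [h] at hlt; exact lt_irrefl _ hlt, hpuv, hpvu⟩
  -- ### gluing: the system `B'` on `S ∖ {v}`
  set B' : List (Finset (ℕ × ℕ) × Finset (ℕ × ℕ × ℕ)) :=
    B.map fun F => (parityImage (gluePair u v) F.1, parityImage (glueTriple u v) F.2) with hB'_def
  have hGascB : ∀ F ∈ B, ∀ p ∈ F.1, (gluePair u v p).1 ∈ S.erase v ∧
      (gluePair u v p).2 ∈ S.erase v ∧ r (gluePair u v p).1 < r (gluePair u v p).2 := by
    intro F hF p hp
    obtain ⟨F', hF', hp'⟩ := hBmem F hF p hp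
    have hpij : p ≠ (i, j) := fun h => hBij F hF (h ▸ hp)
    obtain ⟨h1, h2, hlt, -, -, hfr⟩ := hpair F' hF' p hp' hpij
    exact hGasc p h1 h2 hlt hpij hfr
  have hB'asc : ∀ F' ∈ B', ∀ q ∈ F'.1, q.1 ∈ S.erase v ∧ q.2 ∈ S.erase v ∧ r q.1 < r q.2 := by
    intro F' hF' q hq
    rw [hB'_def, List.mem_map] at hF'
    obtain ⟨F, hF, rfl⟩ := hF'
    obtain ⟨p, hp, rfl⟩ := exists_of_mem_parityImage hq
    exact hGascB F hF p hp
  have hB'par : ∀ F ∈ B, pairParity r (parityImage (gluePair u v) F.1) = pairParity r F.1 := by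
    intro F hF
    unfold pairParity
    rw [sum_parityImage]
    refine Finset.sum_congr rfl fun p hp => ?_
    obtain ⟨-, -, hlt'⟩ := hGascB F hF p hp
    obtain ⟨F', hF', hp'⟩ := hBmem F hF p hp
    obtain ⟨-, -, hlt⟩ := hΦ F' hF' p hp'
    unfold cmpBit; rw [if_pos hlt', if_pos hlt]
  -- ### induction hypothesis on the glued system
  have hlen' : B'.length + 1 = Φ.length := by rw [hB'_def, List.length_map]; exact hBlen
  obtain ⟨r₁, W', hr₁, hW', hval', hwit'⟩ := ih B' hlen' hB'asc
  have hBval : ∀ F ∈ B, pairParity r₁ (parityImage (gluePair u v) F.1) +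
      wParity W' (parityImage (glueTriple u v) F.2) = pairParity r F.1 := by
    intro F hF
    have hFB' : (parityImage (gluePair u v) F.1, parityImage (glueTriple u v) F.2) ∈ B' := by
      rw [hB'_def, List.mem_map]; exact ⟨F, hF, rfl⟩
    have := hval' _ hFB'
    simp only at this
    rw [this, hB'par F hF]
  -- ### lift
  obtain ⟨r', W, hr', hW, hBv, hF₀v, hw⟩ := glue_step hr₁ hu hv huv hW' hwit' hBval hBpairs
    hijF₀ hq₀uv hF₀pairs
  exact ⟨r', W, hr', hW, hBrec r' W hBv hF₀v, hw⟩

/-! ### Proposition 1′ -/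

/-- **Proposition 1′, oriented form** [Gryaznov–Ovcharov–Riazanov 2024, Prop. 1]: for `|S| = N`, a
ranking `r` injective on `S` with `r s < r t`, and at most `N − 3` forms whose pairs are ascending pairs
of `S`, there are a ranking `r'` injective on `S` and a proper witness set `W ∋ (s, k, t)` giving every
form the value `r` gives it without witnesses. Induction on `N`: glue on the right of `t`, else on the
left of `s`, else the final case. [cite: GryaznovOvcharovRiazanov2024, Proposition 1] -/
theorem exists_ranking_witness_of_ascending (N : ℕ) :
    ∀ (S : Finset ℕ) (r : ℕ → ℕ) (s t : ℕ) (Φ : List (Finset (ℕ × ℕ) × Finset (ℕ × ℕ × ℕ))),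
      S.card = N → Set.InjOn r S → s ∈ S → t ∈ S → r s < r t → Φ.length + 3 ≤ N →
      (∀ F ∈ Φ, ∀ p ∈ F.1, p.1 ∈ S ∧ p.2 ∈ S ∧ r p.1 < r p.2) →
      ∃ (r' : ℕ → ℕ) (W : Finset (ℕ × ℕ × ℕ)), Set.InjOn r' S ∧ WProper S r' W ∧
        (∀ F ∈ Φ, pairParity r' F.1 + wParity W F.2 = pairParity r F.1) ∧ ∃ k, (s, k, t) ∈ W := by
  induction N with
  | zero => intro S r s t Φ _ _ _ _ _ hlen _; omega
  | succ N ih =>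
    intro S r s t Φ hcard hr hs ht hst hlen hΦ
    classical
    have hst' : s ≠ t := fun h => by rw [h] at hst; exact lt_irrefl _ hst
    -- the occurring pairs
    set P : Finset (ℕ × ℕ) := Φ.toFinset.biUnion Prod.fst with hP_def
    have hP : ∀ p, p ∈ P ↔ ∃ F ∈ Φ, p ∈ F.1 := by
      intro p
      rw [hP_def, Finset.mem_biUnion]
      simp only [List.mem_toFinset]
    -- the induction hypothesis on `S ∖ {v}`, in the shape `glue_case` wants
    have ih' : ∀ v ∈ S, v ≠ s → v ≠ t →
        ∀ Φ' : List (Finset (ℕ × ℕ) × Finset (ℕ × ℕ × ℕ)), Φ'.length + 1 = Φ.length →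
        (∀ F ∈ Φ', ∀ p ∈ F.1, p.1 ∈ S.erase v ∧ p.2 ∈ S.erase v ∧ r p.1 < r p.2) →
        ∃ (r₁ : ℕ → ℕ) (W' : Finset (ℕ × ℕ × ℕ)), Set.InjOn r₁ (S.erase v : Finset ℕ) ∧
          WProper (S.erase v) r₁ W' ∧
          (∀ F ∈ Φ', pairParity r₁ F.1 + wParity W' F.2 = pairParity r F.1) ∧ ∃ k, (s, k, t) ∈ W' := by
      intro v hv hvs hvt Φ' hlen' hΦ'
      exact ih (S.erase v) r s t Φ' (by rw [Finset.card_erase_of_mem hv, hcard]; rfl)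
        (hr.mono (Finset.coe_subset.2 (Finset.erase_subset v S)))
        (Finset.mem_erase.2 ⟨Ne.symm hvs, hs⟩) (Finset.mem_erase.2 ⟨Ne.symm hvt, ht⟩) hst
        (by omega) hΦ'
    by_cases hR : (P.filter fun p => r t ≤ r p.1).Nonempty
    · -- ### RIGHT: an occurring pair `(i, j)` with `t ⪯ i`, of minimal length; glue `j` into `i`
      obtain ⟨q, hqA, hqmin⟩ := Finset.exists_min_image _ (fun p => r p.2 - r p.1) hR
      obtain ⟨i, j⟩ := q
      have hijP : (i, j) ∈ P := (Finset.mem_filter.1 hqA).1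
      have hti : r t ≤ r i := by simpa using (Finset.mem_filter.1 hqA).2
      obtain ⟨F₀, hF₀, hijF₀⟩ := (hP _).1 hijP
      have hiS : i ∈ S := (hΦ F₀ hF₀ (i, j) hijF₀).1
      have hjS : j ∈ S := (hΦ F₀ hF₀ (i, j) hijF₀).2.1
      have hrij : r i < r j := (hΦ F₀ hF₀ (i, j) hijF₀).2.2
      have hij : i ≠ j := fun h => by rw [h] at hrij; exact lt_irrefl _ hrij
      have hjs : j ≠ s := fun h => by rw [h] at hrij; omega
      have hjt : j ≠ t := fun h => by rw [h] at hrij; omega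
      have hfree : ∀ F ∈ Φ, ∀ p ∈ F.1, p ≠ (i, j) → ¬ (r i ≤ r p.1 ∧ r p.2 ≤ r j) := by
        intro F hF p hp hpij ⟨hi1, h2j⟩
        obtain ⟨h1, h2, hlt⟩ := hΦ F hF p hp
        have hpA : p ∈ P.filter (fun p => r t ≤ r p.1) :=
          Finset.mem_filter.2 ⟨(hP p).2 ⟨F, hF, hp⟩, by omega⟩
        have hle : r j - r i ≤ r p.2 - r p.1 := by simpa using hqmin p hpA
        have he1 : r p.1 = r i := by omega
        have he2 : r p.2 = r j := by omega
        exact hpij (Prod.ext (hr h1 hiS he1) (hr h2 hjS he2))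
      refine glue_case (u := i) (v := j) hiS hjS hij (Or.inl rfl) hrij hΦ hF₀ hijF₀ hfree ?_
        (ih' j hjS hjs hjt)
      -- glued pairs are ascending pairs of `S ∖ {j}`
      intro p h1 h2 hlt hpij hfr
      refine ⟨glue_mem_erase hiS hij h1, glue_mem_erase hiS hij h2, ?_⟩
      simp only [gluePair, glue]
      by_cases hp1 : p.1 = j <;> by_cases hp2 : p.2 = j
      · rw [hp1, hp2] at hlt; exact absurd hlt (lt_irrefl _)
      · rw [if_pos hp1, if_neg hp2]; rw [hp1] at hlt; omega
      · rw [if_neg hp1, if_pos hp2]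
        rw [hp2] at hfr
        by_contra hge
        exact hfr ⟨not_lt.1 hge, le_rfl⟩
      · rw [if_neg hp1, if_neg hp2]; exact hlt
    · by_cases hL : (P.filter fun p => r p.2 ≤ r s).Nonempty
      · -- ### LEFT: an occurring pair `(i, j)` with `j ⪯ s`, of minimal length; glue `i` into `j`
        obtain ⟨q, hqA, hqmin⟩ := Finset.exists_min_image _ (fun p => r p.2 - r p.1) hL
        obtain ⟨i, j⟩ := q
        have hijP : (i, j) ∈ P := (Finset.mem_filter.1 hqA).1
        have hjs' : r j ≤ r s := by simpa using (Finset.mem_filter.1 hqA).2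
        obtain ⟨F₀, hF₀, hijF₀⟩ := (hP _).1 hijP
        have hiS : i ∈ S := (hΦ F₀ hF₀ (i, j) hijF₀).1
        have hjS : j ∈ S := (hΦ F₀ hF₀ (i, j) hijF₀).2.1
        have hrij : r i < r j := (hΦ F₀ hF₀ (i, j) hijF₀).2.2
        have hij : i ≠ j := fun h => by rw [h] at hrij; exact lt_irrefl _ hrij
        have his : i ≠ s := fun h => by rw [h] at hrij; omega
        have hit : i ≠ t := fun h => by rw [h] at hrij; omega
        have hfree : ∀ F ∈ Φ, ∀ p ∈ F.1, p ≠ (i, j) → ¬ (r i ≤ r p.1 ∧ r p.2 ≤ r j) := by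
          intro F hF p hp hpij ⟨hi1, h2j⟩
          obtain ⟨h1, h2, hlt⟩ := hΦ F hF p hp
          have hpA : p ∈ P.filter (fun p => r p.2 ≤ r s) :=
            Finset.mem_filter.2 ⟨(hP p).2 ⟨F, hF, hp⟩, by omega⟩
          have hle : r j - r i ≤ r p.2 - r p.1 := by simpa using hqmin p hpA
          have he1 : r p.1 = r i := by omega
          have he2 : r p.2 = r j := by omega
          exact hpij (Prod.ext (hr h1 hiS he1) (hr h2 hjS he2))
        refine glue_case (u := j) (v := i) hjS hiS (Ne.symm hij) (Or.inr rfl) hrij hΦ hF₀ hijF₀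
          hfree ?_ (ih' i hiS his hit)
        -- glued pairs are ascending pairs of `S ∖ {i}`
        intro p h1 h2 hlt hpij hfr
        refine ⟨glue_mem_erase hjS (Ne.symm hij) h1, glue_mem_erase hjS (Ne.symm hij) h2, ?_⟩
        simp only [gluePair, glue]
        by_cases hp1 : p.1 = i <;> by_cases hp2 : p.2 = i
        · rw [hp1, hp2] at hlt; exact absurd hlt (lt_irrefl _)
        · rw [if_pos hp1, if_neg hp2]
          rw [hp1] at hfr
          by_contra hge
          exact hfr ⟨le_rfl, not_lt.1 hge⟩
        · rw [if_neg hp1, if_pos hp2]; rw [hp2] at hlt; omega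
        · rw [if_neg hp1, if_neg hp2]; exact hlt
      · -- ### FINAL: no occurring pair starts at/above `t` or ends at/below `s`
        have hfree : ∀ F ∈ Φ, ∀ p ∈ F.1, r p.1 < r t ∧ r s < r p.2 := by
          intro F hF p hp
          have hpP := (hP p).2 ⟨F, hF, hp⟩
          constructor
          · by_contra h
            exact hR ⟨p, Finset.mem_filter.2 ⟨hpP, not_lt.1 h⟩⟩
          · by_contra h
            exact hL ⟨p, Finset.mem_filter.2 ⟨hpP, not_lt.1 h⟩⟩
        exact exists_ranking_witness_final hr hs ht hst (by omega) hΦ hfree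

/-- **Proposition 1′** [Gryaznov–Ovcharov–Riazanov 2024, Prop. 1 ("Let `Av = b` be a linear system in
the variables `v = (x_{ij}) ∪ (z_{ikj})` with at most `n − 3` equations that has a `WORDER_n`-proper
solution `σ`, which sets every `z_{ikj}` to zero. Then for every density clause `D_{st}` there is a
`WORDER_n`-proper solution `τ` of `Av = b` that satisfies `D_{st}` …"), in ranking language, without
the printed restriction on `τ`'s witnesses]: at most `|S| − 3` forms with off-diagonal pairs of `S`, a
ranking `r` injective on `S` with `r s < r t` ⇒ a ranking `r'` injective on `S` and a proper witness
set `W` with a witness `(s, k, t)` such that every form has the same value under `(r', W)` as under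
`(r, ∅)`. [cite: GryaznovOvcharovRiazanov2024, Proposition 1] -/
theorem exists_ranking_witness {S : Finset ℕ} {r : ℕ → ℕ} (hr : Set.InjOn r S) {s t : ℕ}
    (hs : s ∈ S) (ht : t ∈ S) (hst : r s < r t)
    {Φ : List (Finset (ℕ × ℕ) × Finset (ℕ × ℕ × ℕ))} (hlen : Φ.length + 3 ≤ S.card)
    (hΦ : ∀ F ∈ Φ, ∀ p ∈ F.1, p.1 ∈ S ∧ p.2 ∈ S ∧ p.1 ≠ p.2) :
    ∃ (r' : ℕ → ℕ) (W : Finset (ℕ × ℕ × ℕ)), Set.InjOn r' S ∧ WProper S r' W ∧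
      (∀ F ∈ Φ, pairParity r' F.1 + wParity W F.2 = pairParity r F.1) ∧ ∃ k, (s, k, t) ∈ W := by
  classical
  set Ψ : List (Finset (ℕ × ℕ) × Finset (ℕ × ℕ × ℕ)) :=
    Φ.map fun F => (parityImage (orient r) F.1, F.2) with hΨ
  have hΨlen : Ψ.length + 3 ≤ S.card := by rw [hΨ, List.length_map]; exact hlen
  have hΨasc : ∀ F' ∈ Ψ, ∀ q ∈ F'.1, q.1 ∈ S ∧ q.2 ∈ S ∧ r q.1 < r q.2 := by
    intro F' hF' q hq
    rw [hΨ, List.mem_map] at hF'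
    obtain ⟨F, hF, rfl⟩ := hF'
    exact ascending_of_mem_parityImage_orient hr (hΦ F hF) hq
  obtain ⟨r', W, hr', hW, hval, hwit⟩ :=
    exists_ranking_witness_of_ascending S.card S r s t Ψ rfl hr hs ht hst hΨlen hΨasc
  refine ⟨r', W, hr', hW, fun F hF => ?_, hwit⟩
  have hF' : (parityImage (orient r) F.1, F.2) ∈ Ψ := by rw [hΨ, List.mem_map]; exact ⟨F, hF, rfl⟩
  have key := hval _ hF'
  simp only at key
  rw [pairParity_parityImage_orient hr' (hΦ F hF), pairParity_parityImage_orient hr (hΦ F hF)] at key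
  -- cancel the orientation constant
  linear_combination key

end OrderParity

end Literature.Computability.MetaComplexity
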